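import Literature.NumberTheory.EllipticCurves.Kobayashi2003.SignedSelmerPairChangeInvariantsProofs
import Literature.NumberTheory.EllipticCurves.KatoRankBoundProofs
import Literature.NumberTheory.EllipticCurves.LeadingTermPPartProofs
import HarnessLib

/-!
# The constant term of `char X^ε(E/K_∞)` up to a `p`-adic unit — B. D. Kim's Euler-characteristic
# identity — does not depend on the cyclotomic `ℤ_p`-extension datum `(κ, γ)` (proofs)

`Proofs` file (theorems only; no definition, no named fact) in the cluster `Kobayashi2003`, continuing
`SignedSelmerPairChangeInvariantsProofs.lean` (the `Γ`-invariants and coinvariants of `Sel^ε(E/K_∞)`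
do not depend on the pair). B. D. Kim's identity (J. Aust. Math. Soc. 95 (2013), Cor. 3.15: the
constant term of a characteristic power series of `X^±(E/ℚ_∞)` is `∼ #Sel_{p^∞}(E/ℚ) · ∏ c_ℓ`) is,
through Greenberg's Lemma 4.2 (`g(0) · #X[T] = unit · #X/TX`) and Pontryagin duality
(`#X/TX = #Sel^γ`, `#X[T] = #Sel_γ`), a statement about the two cardinalities of the previous file;
hence it holds at every cyclotomic top-generator pair as soon as it holds at one:

* §5 `SignedSelmerDualData.exists_units_constantCoeff_eq_of_isCyclotomic` — for cyclotomic pairs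
  `(κ₁, γ₁)`, `(κ₂, γ₂)` (top generators), data `D₁, D₂` with `X₁` torsion and `X₁/TX₁` finite, and
  generators `g₁, g₂` of the characteristic ideals: `X₂` is torsion, `X₂/TX₂` is finite and
  `g₂(0) = w · g₁(0)` for a unit `w ∈ ℤ_pˣ` (`κ₂ = u • κ₁`, so `κ₁ γ₂ = u⁻¹`; §3–§4 of the previous
  file; `IwasawaAlgebra.constantCoeff_charGenerator_mul_natCard_invariants` on both sides);
* §6 `kimEulerChar_of_kimEulerChar_normalised` — over `ℚ`: Kim's identity
  `g(0) = u · p^{v_p ∏c_ℓ} · #Sel_{p^∞}(E/ℚ)` for every generator `g` of `char X^ε`, if known at the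
  NORMALISED cyclotomic pairs (`IsCyclotomicVariable p γ`, the tree's convention for main-conjecture
  statements), holds at every cyclotomic top-generator pair.
Consumer: the W-ALL cell's item stmt-BirchSwinnertonDyer-20312 (skeleton `rankzero`, stub
`stub_kimControlCMTwo` stated at all pairs; the composition and the necessity certificate use the
normalised pairs). Nothing about any curve's Selmer group is asserted.

## References
* [GreenbergLNM1716] R. Greenberg, LNM 1716 (1999), §1 p. 60, §4 Lemma 4.2 (pp. 102–103).
* [BDKim2013] B. D. Kim, J. Aust. Math. Soc. 95 (2013), Cor. 3.15 (p. 199).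
* [Washington1997] L. Washington, *Introduction to Cyclotomic Fields*, §13.1.
-/

noncomputable section

open scoped Classical

universe u

namespace Literature.NumberTheory.EllipticCurves.Kobayashi2003

open Literature.NumberTheory.EllipticCurves Literature.NumberTheory.EllipticCurves.IwasawaDual
  WeierstrassCurve ZpExtension

/-! ## §5 The `X`-side: the constant term of `char X^ε` up to a unit is the same for all cyclotomic pairs -/

section ConstantTerm

variable {K : Type u} [Field K] [NumberField K] {W : WeierstrassCurve K} [W.IsElliptic] {p : ℕ}
  [Fact p.Prime] {ε : ℤˣ}

/-- **The constant term of `char X^ε(E/K_∞)` up to a `p`-adic unit does not depend on the cyclotomic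
pair.** Let `κ₁, κ₂` be cyclotomic with topological generators `γ₁, γ₂`, `D₁, D₂` Pontryagin-dual data
of `Sel^ε(E/K_∞)` for the two pairs, `X₁ = D₁.X` torsion with `X₁/TX₁` finite, and `g₁, g₂` generators
of the characteristic ideals. Then `X₂` is torsion, `X₂/TX₂` is finite, and `g₂(0) = w·g₁(0)` for some
`w ∈ ℤ_pˣ`. Proof: `κ₂ = u • κ₁` (`IsCyclotomic.exists_eq_unitTwist`), so `κ₁ γ₂ = u⁻¹ ∈ ℤ_pˣ` and
`κ₁ γ₁ = 1`; by §3 the kernel and the image of `conj_{γ₁} − 1` and of `conj_{γ₂} − 1` on `Sel^ε_∞(κ₁)`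
coincide, and by §4 those of `conj_{γ₂} − 1` on `Sel^ε_∞(κ₂)` and on `Sel^ε_∞(κ₁)` are equipotent;
Pontryagin duality (`IsDualPair.natCard_coinvariants`: `#X/TX = #Sel^γ`; `natCard_invariants`:
`#X[T] = #Sel_γ`) and Greenberg's Lemma 4.2 `g(0)·#X[T] = unit·#X/TX`
(`IwasawaAlgebra.constantCoeff_charGenerator_mul_natCard_invariants`) on both data, cancelling
`#X[T] ≠ 0`; torsion of `X₂` by `isTorsion_of_finite_endInvariants`.
[cite: GreenbergLNM1716, §1 p. 60 and §4 Lemma 4.2 (pp. 102–103)] [cite: Washington1997, §13.1] -/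
theorem SignedSelmerDualData.exists_units_constantCoeff_eq_of_isCyclotomic
    {κ₁ κ₂ : ZpExtension K p} (h₁ : κ₁.IsCyclotomic) (h₂ : κ₂.IsCyclotomic)
    {γ₁ γ₂ : Field.absoluteGaloisGroup K} (hγ₁ : κ₁.IsTopGenerator γ₁) (hγ₂ : κ₂.IsTopGenerator γ₂)
    (D₁ : SignedSelmerDualData W κ₁ γ₁ ε) (D₂ : SignedSelmerDualData W κ₂ γ₂ ε)
    (hT₁ : Module.IsTorsion (IwasawaAlgebra p) D₁.X)
    (hfin₁ : Finite (IwasawaAlgebra.coinvariants p D₁.X))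
    {g₁ g₂ : IwasawaAlgebra p} (hg₁ : D₁.charIdeal = Ideal.span {g₁})
    (hg₂ : D₂.charIdeal = Ideal.span {g₂}) :
    Module.IsTorsion (IwasawaAlgebra p) D₂.X ∧ Finite (IwasawaAlgebra.coinvariants p D₂.X) ∧
      ∃ w : ℤ_[p]ˣ, PowerSeries.constantCoeff g₂ = w * PowerSeries.constantCoeff g₁ := by
  haveI := D₁.moduleFinite hγ₁
  haveI := D₂.moduleFinite hγ₂
  -- `κ₂ = u • κ₁`, so `κ₁ γ₂ = u⁻¹` is a unit, and `κ₁ γ₁ = 1`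
  obtain ⟨u, hu⟩ := ZpExtension.IsCyclotomic.exists_eq_unitTwist_holds h₁ h₂
  have hγ₂' : κ₁ γ₂ = Multiplicative.ofAdd ((u⁻¹ : ℤ_[p]ˣ) : ℤ_[p]) := by
    have h := hγ₂
    rw [ZpExtension.IsTopGenerator, hu, ZpExtension.unitTwist_apply] at h
    have h' : (u : ℤ_[p]) * (κ₁ γ₂).toAdd = 1 := by
      have := congrArg Multiplicative.toAdd h
      rwa [toAdd_ofAdd, toAdd_ofAdd] at this
    apply Multiplicative.toAdd.injective
    rw [toAdd_ofAdd]
    calc (κ₁ γ₂).toAdd = ((u⁻¹ : ℤ_[p]ˣ) : ℤ_[p]) * ((u : ℤ_[p]) * (κ₁ γ₂).toAdd) := by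
          rw [← mul_assoc, Units.inv_mul, one_mul]
      _ = ((u⁻¹ : ℤ_[p]ˣ) : ℤ_[p]) := by rw [h', mul_one]
  have hγ₁' : κ₁ γ₁ = Multiplicative.ofAdd (1 : ℤ_[p]) := hγ₁
  -- S-side: within `κ₁`, the pairs `γ₁`, `γ₂` give the same invariants / image
  set ψ₁ := conjSignedSelmerInfty W κ₁ ε γ₁ - 1 with hψ₁
  set ψ₁' := conjSignedSelmerInfty W κ₁ ε γ₂ - 1 with hψ₁'
  set ψ₂ := conjSignedSelmerInfty W κ₂ ε γ₂ - 1 with hψ₂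
  have hInv : endInvariants ψ₁ = endInvariants ψ₁' :=
    endInvariants_conjSignedSelmerInfty_eq_of_isUnit W κ₁ ε hγ₁' isUnit_one hγ₂' (Units.isUnit _)
  have hRan : AddMonoidHom.range (AddMonoidHomClass.toAddMonoidHom ψ₁) =
      AddMonoidHom.range (AddMonoidHomClass.toAddMonoidHom ψ₁') :=
    range_conjSignedSelmerInfty_sub_one_eq_of_isUnit W κ₁ ε hγ₁' isUnit_one hγ₂' (Units.isUnit _)
  -- transport `κ₂ → κ₁` at `σ = γ₂`
  obtain ⟨⟨eInv⟩, ⟨eCo⟩⟩ := nonempty_endInvariants_equiv_of_isCyclotomic W ε h₁ h₂ γ₂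
  -- the four cardinalities
  have hcI : Nat.card (endInvariants ψ₂) = Nat.card (endInvariants ψ₁) := by
    rw [Nat.card_congr eInv, hInv]
  have hcC : Nat.card (EndCoinvariants ψ₂) = Nat.card (EndCoinvariants ψ₁) := by
    rw [Nat.card_congr eCo.toEquiv]
    exact Nat.card_congr (QuotientAddGroup.quotientAddEquivOfEq hRan).symm.toEquiv
  -- duality on both sides
  have hd₁ := D₁.isDualPair hγ₁
  have hd₂ := D₂.isDualPair hγ₂
  have hfinI₁ : Finite (endInvariants ψ₁) := hd₁.finite_coinvariants_iff.mp hfin₁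
  have hfinI₂ : Finite (endInvariants ψ₂) := by
    rw [hInv] at hfinI₁
    exact Finite.of_equiv _ eInv.symm
  have hT₂ : Module.IsTorsion (IwasawaAlgebra p) D₂.X := D₂.isTorsion_of_finite_endInvariants hγ₂ hfinI₂
  have hfin₂ : Finite (IwasawaAlgebra.coinvariants p D₂.X) := hd₂.finite_coinvariants_iff.mpr hfinI₂
  refine ⟨hT₂, hfin₂, ?_⟩
  -- Greenberg's Lemma 4.2 on both data
  obtain ⟨u₁, hu₁⟩ :=
    IwasawaAlgebra.constantCoeff_charGenerator_mul_natCard_invariants p D₁.X hT₁ g₁ hg₁ hfin₁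
  obtain ⟨u₂, hu₂⟩ :=
    IwasawaAlgebra.constantCoeff_charGenerator_mul_natCard_invariants p D₂.X hT₂ g₂ hg₂ hfin₂
  rw [hd₁.natCard_invariants, hd₁.natCard_coinvariants] at hu₁
  rw [hd₂.natCard_invariants, hd₂.natCard_coinvariants, hcI, hcC] at hu₂
  -- cancel `#X[T] ≠ 0`
  haveI : Finite (IwasawaAlgebra.invariants p D₁.X) :=
    (IwasawaAlgebra.finite_invariants_iff_finite_coinvariants p D₁.X hT₁).mpr hfin₁
  haveI : Finite (EndCoinvariants ψ₁) := hd₁.finite_invariants_iff.mp inferInstance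
  have hI0 : (Nat.card (EndCoinvariants ψ₁) : ℤ_[p]) ≠ 0 := by
    exact_mod_cast (Nat.card_pos (α := EndCoinvariants ψ₁)).ne'
  refine ⟨u₂ * u₁⁻¹, ?_⟩
  have key : PowerSeries.constantCoeff g₂ * (u₁ : ℤ_[p]) * (Nat.card (EndCoinvariants ψ₁) : ℤ_[p]) =
      (u₂ : ℤ_[p]) * (u₁⁻¹ : ℤ_[p]ˣ) * (u₁ : ℤ_[p]) * PowerSeries.constantCoeff g₁ *
        (Nat.card (EndCoinvariants ψ₁) : ℤ_[p]) := by
    calc PowerSeries.constantCoeff g₂ * (u₁ : ℤ_[p]) * (Nat.card (EndCoinvariants ψ₁) : ℤ_[p])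
        = (u₁ : ℤ_[p]) * (PowerSeries.constantCoeff g₂ * (Nat.card (EndCoinvariants ψ₁) : ℤ_[p])) := by
          ring
      _ = (u₁ : ℤ_[p]) * ((u₂ : ℤ_[p]) * (Nat.card (endInvariants ψ₁) : ℤ_[p])) := by rw [hu₂]
      _ = (u₂ : ℤ_[p]) * ((u₁ : ℤ_[p]) * (Nat.card (endInvariants ψ₁) : ℤ_[p])) := by ring
      _ = (u₂ : ℤ_[p]) * (PowerSeries.constantCoeff g₁ * (Nat.card (EndCoinvariants ψ₁) : ℤ_[p])) := by
          rw [hu₁]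
      _ = (u₂ : ℤ_[p]) * (u₁⁻¹ : ℤ_[p]ˣ) * (u₁ : ℤ_[p]) * PowerSeries.constantCoeff g₁ *
            (Nat.card (EndCoinvariants ψ₁) : ℤ_[p]) := by
          rw [Units.inv_mul_cancel_right]; ring
  have key' := mul_right_cancel₀ hI0 key
  have hu₁0 : (u₁ : ℤ_[p]) ≠ 0 := u₁.ne_zero
  calc PowerSeries.constantCoeff g₂
      = PowerSeries.constantCoeff g₂ * (u₁ : ℤ_[p]) * (u₁⁻¹ : ℤ_[p]ˣ) := by
        rw [Units.mul_inv_cancel_right]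
    _ = (u₂ : ℤ_[p]) * (u₁⁻¹ : ℤ_[p]ˣ) * (u₁ : ℤ_[p]) * PowerSeries.constantCoeff g₁ * (u₁⁻¹ : ℤ_[p]ˣ) := by
        rw [key']
    _ = ((u₂ * u₁⁻¹ : ℤ_[p]ˣ) : ℤ_[p]) * PowerSeries.constantCoeff g₁ := by
        rw [Units.val_mul]
        calc (u₂ : ℤ_[p]) * (u₁⁻¹ : ℤ_[p]ˣ) * (u₁ : ℤ_[p]) * PowerSeries.constantCoeff g₁ * (u₁⁻¹ : ℤ_[p]ˣ)
            = (u₂ : ℤ_[p]) * (u₁⁻¹ : ℤ_[p]ˣ) * PowerSeries.constantCoeff g₁ *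
                ((u₁ : ℤ_[p]) * (u₁⁻¹ : ℤ_[p]ˣ)) := by ring
          _ = (u₂ : ℤ_[p]) * (u₁⁻¹ : ℤ_[p]ˣ) * PowerSeries.constantCoeff g₁ := by
                rw [Units.mul_inv, mul_one]

end ConstantTerm

/-! ## §6 B. D. Kim's Euler-characteristic identity at ALL cyclotomic top-generator pairs from the
normalised ones -/

section KimTerm

variable (W : WeierstrassCurve ℚ) [W.IsElliptic] {p : ℕ} [Fact p.Prime] (ε : ℤˣ)

/-- **B. D. Kim's Euler-characteristic identity is pair-independent.** For `E = W/ℚ` and a sign `ε`: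
if for every NORMALISED cyclotomic pair (`κ` cyclotomic, `κ γ = 1`, `IsCyclotomicVariable p γ` — the
tree's convention in `KobayashiMainConjecture`/`KobayashiLowerDivisibility`), every f.g. torsion dual
datum `D` of `Sel^ε(E/ℚ_∞)` and every generator `g` of `char X^ε` one has, when `Sel_{p^∞}(E/ℚ)` is
finite, `g(0) = u · p^{v_p ∏c_ℓ} · #Sel_{p^∞}(E/ℚ)` with `u ∈ ℤ_pˣ` (the shape of Kim 2013 Cor. 3.15 as
typed in `BDKim2013.cor315_signedCharValue_rankZero`), then the same holds at EVERY cyclotomic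
top-generator pair: the tree's normalised pair exists
(`exists_isCyclotomic_isTopGenerator_isCyclotomicVariable_holds`), torsion moves across pairs
(`isTorsion_of_isTorsion_of_isCyclotomic`), the identity there gives `g₁(0) ≠ 0`, hence `X₁/TX₁` finite
(Greenberg's Lemma 4.2, `finite_coinvariants_of_constantCoeff_ne_zero`), and §5 transports the
constant term up to a unit. [cite: BDKim2013, Cor. 3.15 (p. 199)] [cite: GreenbergLNM1716, §4 Lemma 4.2] -/
theorem kimEulerChar_of_kimEulerChar_normalised
    (hKim : ∀ (κ : ZpExtension ℚ p) (γ : Field.absoluteGaloisGroup ℚ),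
      κ.IsCyclotomic → κ.IsTopGenerator γ → IsCyclotomicVariable p γ →
      ∀ (D : SignedSelmerDualData W κ γ ε) [Module.Finite (IwasawaAlgebra p) D.X],
        Module.IsTorsion (IwasawaAlgebra p) D.X →
      ∀ g : IwasawaAlgebra p, D.charIdeal = Ideal.span {g} → Finite (W.selmerGroupPInfty p) →
        ∃ u : ℤ_[p]ˣ, ((PowerSeries.constantCoeff g : ℤ_[p]) : ℚ_[p]) =
          ((u : ℤ_[p]) : ℚ_[p]) * ((p : ℕ) : ℚ_[p]) ^ (padicValNat p W.tamagawaProduct) *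
            (Nat.card (W.selmerGroupPInfty p) : ℚ_[p])) :
    ∀ (κ : ZpExtension ℚ p) (γ : Field.absoluteGaloisGroup ℚ),
      κ.IsCyclotomic → κ.IsTopGenerator γ →
      ∀ (D : SignedSelmerDualData W κ γ ε) [Module.Finite (IwasawaAlgebra p) D.X],
        Module.IsTorsion (IwasawaAlgebra p) D.X →
      ∀ g : IwasawaAlgebra p, D.charIdeal = Ideal.span {g} → Finite (W.selmerGroupPInfty p) →
        ∃ u : ℤ_[p]ˣ, ((PowerSeries.constantCoeff g : ℤ_[p]) : ℚ_[p]) =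
          ((u : ℤ_[p]) : ℚ_[p]) * ((p : ℕ) : ℚ_[p]) ^ (padicValNat p W.tamagawaProduct) *
            (Nat.card (W.selmerGroupPInfty p) : ℚ_[p]) := by
  intro κ₂ γ₂ h₂ hγ₂ D₂ _ hT₂ g₂ hg₂ hfinSel
  -- the tree's normalised pair `(κ₁, γ₁)`, a datum `D₁`, torsion by pair change, a generator `g₁`
  obtain ⟨κ₁, h₁, γ₁, hγ₁, hγ₁'⟩ := exists_isCyclotomic_isTopGenerator_isCyclotomicVariable_holds p
  obtain ⟨D₁⟩ := nonempty_signedSelmerDualData W κ₁ ε hγ₁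
  haveI := D₁.moduleFinite hγ₁
  have hT₁ : Module.IsTorsion (IwasawaAlgebra p) D₁.X :=
    SignedSelmerDualData.isTorsion_of_isTorsion_of_isCyclotomic h₂ h₁ hγ₂ D₂ D₁ hT₂
  obtain ⟨g₁, hg₁⟩ := (charIdeal_isPrincipal_holds p D₁.X).principal
  have hg₁' : D₁.charIdeal = Ideal.span {g₁} := hg₁
  -- Kim's identity at the normalised pair: `g₁(0) ≠ 0`, so `X₁/TX₁` is finite
  obtain ⟨u₁, hu₁⟩ := hKim κ₁ γ₁ h₁ hγ₁ hγ₁' D₁ hT₁ g₁ hg₁' hfinSel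
  have hpP : p.Prime := Fact.out
  have hS0 : (Nat.card (W.selmerGroupPInfty p) : ℚ_[p]) ≠ 0 := by
    haveI := hfinSel
    exact_mod_cast (Nat.card_pos (α := W.selmerGroupPInfty p)).ne'
  have hP0 : ((p : ℕ) : ℚ_[p]) ^ (padicValNat p W.tamagawaProduct) ≠ 0 :=
    pow_ne_zero _ (by exact_mod_cast hpP.ne_zero)
  have hg₁0 : PowerSeries.constantCoeff g₁ ≠ 0 := by
    intro h0
    rw [h0, PadicInt.coe_zero] at hu₁
    exact mul_ne_zero (mul_ne_zero (coe_units_ne_zero p u₁) hP0) hS0 hu₁.symm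
  have hmem : g₁ ∈ Module.charIdeal (IwasawaAlgebra p) D₁.X := by
    change g₁ ∈ D₁.charIdeal
    rw [hg₁']
    exact Ideal.mem_span_singleton_self g₁
  have hfin₁ : Finite (IwasawaAlgebra.coinvariants p D₁.X) :=
    IwasawaAlgebra.finite_coinvariants_of_constantCoeff_ne_zero p D₁.X hT₁ g₁ hmem hg₁0
  -- pair change for the constant term
  obtain ⟨-, -, w, hw⟩ := SignedSelmerDualData.exists_units_constantCoeff_eq_of_isCyclotomic h₁ h₂ hγ₁
    hγ₂ D₁ D₂ hT₁ hfin₁ hg₁' hg₂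
  refine ⟨w * u₁, ?_⟩
  rw [hw, PadicInt.coe_mul, hu₁, Units.val_mul, PadicInt.coe_mul]
  ring

end KimTerm

end Literature.NumberTheory.EllipticCurves.Kobayashi2003

end
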